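import Summits.CriticalPhenomena.PercolationContinuityZ3.Theses.PercExchangeRateTransport
import Literature.Probability.Percolation.PercolationProofs
import Literature.Probability.Percolation.SharpnessDCTProofs
import Summits.CriticalPhenomena.PercolationContinuityZ3.Theorems.CriticalCurveRegular.Negative.RightEndpoint
import Summits.CriticalPhenomena.PercolationContinuityZ3.Theorems.PercExchangeRateTransportSubcritExchangeUniformityRussoPos

/-!
# `ModelFacts` (crux stmt-CriticalPhenomena-16064, route `PercExchangeRateTransport`):
# the closed edges `p = 1`, `p = 0`, `t = 1` of the parameter square — tightness of the
# open-square guard in clause (8)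

Negative / tightness lemmas from the crux disprover (nothing here asserts the crux; companion of
`Negative/DerivPosGuard.lean`, which records the degenerate box `n = 0`).  Def- and notation-free:
the crux's `vert`, `cfg`, `Θ` are written out literally in every statement.  Reused from the
tree: `CriticalCurveRegular.Negative.measure_label_gt_one` (a label exceeds `1` with probability
`0`), `SubcritExchangeUniformity.single_nat_mem_innerBoundary` (`n eᵢ ∈ ∂Λ_n`) and
`SubcritExchangeUniformity.thetaBox_mono_p` (clause (3), monotonicity in `p`).

For the label-coupled anisotropic family on `ℤ²×ℤ` (x/y-bonds open iff `U_e ≤ p`, z-bonds iff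
`U_e ≤ t`, `U` i.i.d. uniform on `[0,1]` under `labelMeasure (Site 3)`; `Θ_n(p,t) = P(0 ⟷ ∂Λ_n)`):

* `theta_eq_one_of_one_le_p`  — `Θ_n(p,t) = 1` for `p ≥ 1` (a.s. every label is `≤ 1`, so the
  straight `x`-ray `0, e_x, …, n e_x` is open and `n e_x ∈ ∂Λ_n`);
* `theta_eq_one_of_one_le_t`  — `Θ_n(p,t) = 1` for `t ≥ 1` (the vertical ray is open);
* `theta_eq_theta_zero_of_nonpos` — `Θ_n(q,t) = Θ_n(0,t)` for `q ≤ 0` (a.s. every label is `> 0`,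
  so no horizontal bond is open at any level `q ≤ 0`);
* hence `deriv (fun q => Θ_n q t) 1 = 0` (Fermat at the maximum `Θ_n(1,t) = 1 ≥ Θ_n(q,t)`),
  `deriv (fun q => Θ_n q t) p = 0` for `t ≥ 1` (constant function), and
  `deriv (fun q => Θ_n q t) 0 = 0` (Fermat at the minimum: plateau on `q ≤ 0`, monotone on `q ≥ 0`;
  the right derivative is the positive pivotal intensity, so `Θ_n(·,t)` has a corner at `0` and
  Lean's `deriv` returns the junk value `0`).

Consequences for clause (8) of the crux (`0 < ∂_p Θ_n` for `n ≥ 1` on the OPEN square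
`(p,t) ∈ (0,1)²`): the guard is tight on three of the four edges —
`modelFacts_derivPos_false_at_p_one` (`p ∈ Ioc 0 1`), `modelFacts_derivPos_false_at_p_zero`
(`p ∈ Ico 0 1`), `modelFacts_derivPos_false_at_t_one` (`t ∈ Ioc 0 1`) are all FALSE variants.
(The fourth edge `t = 0` is NOT load-bearing: there the family is a.s. planar bond percolation in
`Λ_n ∩ (ℤ²×{0})` and `∂_pΘ_n(p,0) > 0` on `0 < p < 1` still holds — information for provers, not
proved here.) Any proof of clause (8) must therefore use both `p < 1` and `t < 1` (they enter
through `q_e < 1` in `stub_pivotalPos`: at `p = 1` or `t = 1` the bond `s(0,e_x)` is never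
pivotal) and `0 < p` (through `0 < q_e` on the horizontal bonds).
-/

noncomputable section

open MeasureTheory Filter Topology
open Literature.Probability.Percolation Literature.Probability.LatticeModels
open Literature.Probability.Percolation.DCT16

namespace Summit.CriticalPhenomena.PercolationContinuityZ3.Theorems.ModelFacts.Negative

/-! ## Straight coordinate rays in `Λ_n ⊂ ℤ³` -/

/-- `k eᵢ ∈ Λ_n` for `k ≤ n`. [folklore] -/
theorem axis_mem_box (i : Fin 3) {n k : ℕ} (hk : k ≤ n) :
    (Pi.single i (k : ℤ) : Site 3) ∈ box 3 n := by
  rw [mem_box]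
  intro j
  by_cases hj : j = i
  · subst hj
    simp only [Pi.single_eq_same]
    omega
  · simp only [Pi.single_apply, if_neg hj]
    omega

/-- `k eᵢ ∼ (k+1) eᵢ` in `ℤ³`. [folklore] -/
theorem axis_adj_succ (i : Fin 3) (k : ℕ) :
    (zdGraph 3).Adj (Pi.single i (k : ℤ) : Site 3) (Pi.single i ((k + 1 : ℕ) : ℤ)) :=
  (zdGraph_adj_iff _ _).2
    ⟨i, Or.inl (by push_cast; exact Pi.single_add (f := fun _ : Fin 3 => ℤ) i (k : ℤ) 1)⟩

/-- **If the first `n` bonds of the `i`-th coordinate ray are open then `0 ⟷ ∂Λ_n in Λ_n`.**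
[folklore] -/
theorem mem_siteToBoundary_of_axis_open (i : Fin 3) {n : ℕ} {ω : Set (Sym2 (Site 3))}
    (h : ∀ k : ℕ, k < n →
      s((Pi.single i (k : ℤ) : Site 3), Pi.single i ((k + 1 : ℕ) : ℤ)) ∈ ω) :
    ω ∈ siteToBoundary 3 n := by
  rw [mem_siteToBoundary_iff]
  refine ⟨Pi.single i (n : ℤ), SubcritExchangeUniformity.single_nat_mem_innerBoundary i n, ?_⟩
  suffices hp : ∀ k, k ≤ n → PathIn (openGraph ω) ↑(box 3 n) 0 (Pi.single i (k : ℤ)) from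
    hp n le_rfl
  intro k
  induction k with
  | zero =>
    intro _
    simp only [Nat.cast_zero, Pi.single_zero]
    exact PathIn.refl (zero_mem_box 3 n)
  | succ k ih =>
    intro hk
    refine (ih (Nat.le_of_succ_le hk)).tail ?_ (axis_mem_box i hk)
    rw [openGraph_adj]
    exact ⟨h k (Nat.lt_of_succ_le hk), (axis_adj_succ i k).ne⟩

/-- The bonds of the vertical ray are vertical bonds of the crux. [folklore] -/
theorem vert_axis_two (k : ℕ) :
    ∃ x : Site 3, s((Pi.single (2 : Fin 3) (k : ℤ) : Site 3), Pi.single (2 : Fin 3) ((k + 1 : ℕ) : ℤ))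
      = s(x, x + Pi.single (2 : Fin 3) 1) :=
  ⟨Pi.single 2 (k : ℤ), by push_cast; rw [← Pi.single_add]⟩

/-- The bonds of the `x`-ray are not vertical. [folklore] -/
theorem not_vert_axis_zero (k : ℕ) :
    ¬ ∃ x : Site 3, s((Pi.single (0 : Fin 3) (k : ℤ) : Site 3), Pi.single (0 : Fin 3) ((k + 1 : ℕ) : ℤ))
      = s(x, x + Pi.single (2 : Fin 3) 1) := by
  rintro ⟨x, hx⟩
  rw [Sym2.eq_iff] at hx
  rcases hx with ⟨h1, h2⟩ | ⟨h1, h2⟩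
  · subst h1
    have h := congr_fun h2 2
    simp at h
  · subst h2
    have h := congr_fun h1 2
    simp at h

/-! ## Null label events -/

/-- A single label lies in a Lebesgue-null subset of `[0,1]` with probability `0`. [folklore] -/
theorem labelMeasure_eval_null (e : Sym2 (Site 3)) {T : Set ℝ} (hT : MeasurableSet T)
    (h0 : (volume : Measure ℝ) (T ∩ Set.Icc 0 1) = 0) :
    labelMeasure (Site 3) {U | U e ∈ T} = 0 := by
  have : IsProbabilityMeasure ((volume : Measure ℝ).restrict (Set.Icc (0 : ℝ) 1)) :=
    isProbabilityMeasure_volume_restrict_unitInterval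
  have h1 : {U : Sym2 (Site 3) → ℝ | U e ∈ T} = (fun U : Sym2 (Site 3) → ℝ => U e) ⁻¹' T := rfl
  rw [h1, ← Measure.map_apply (measurable_pi_apply e) hT,
    show labelMeasure (Site 3) = Measure.infinitePi (fun _ : Sym2 (Site 3) =>
      (volume : Measure ℝ).restrict (Set.Icc (0 : ℝ) 1)) from rfl,
    Measure.infinitePi_map_eval, Measure.restrict_apply hT, h0]

/-- Almost surely a given label is `> 0`. [folklore] -/
theorem labelMeasure_nonpos_null (e : Sym2 (Site 3)) :
    labelMeasure (Site 3) {U | U e ≤ 0} = 0 := by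
  refine labelMeasure_eval_null e measurableSet_Iic (measure_mono_null ?_ (measure_singleton 0))
  rintro u ⟨hu, hu0, -⟩
  exact le_antisymm hu hu0

/-- Almost surely ALL labels are `≤ 1` (countably many bonds). [folklore] -/
theorem ae_label_le_one : ∀ᵐ U ∂(labelMeasure (Site 3)), ∀ e : Sym2 (Site 3), U e ≤ 1 := by
  rw [ae_all_iff]
  intro e
  rw [ae_iff]
  simpa only [not_le] using CriticalCurveRegular.Negative.measure_label_gt_one e

/-- Almost surely ALL labels are `> 0`. [folklore] -/
theorem ae_label_pos : ∀ᵐ U ∂(labelMeasure (Site 3)), ∀ e : Sym2 (Site 3), 0 < U e := by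
  rw [ae_all_iff]
  intro e
  rw [ae_iff]
  simpa only [not_lt] using labelMeasure_nonpos_null e

/-! ## The three closed edges of the parameter square -/

/-- `0 ≤ Θ_n ≤ 1`. [folklore] -/
theorem theta_le_one (n : ℕ) (p t : ℝ) : (labelMeasure (Site 3)).real {U : Sym2 (Site 3) → ℝ | {e | e ∈ (zdGraph 3).edgeSet ∧ (((∃ x : Site 3, e = s(x, x + Pi.single (2 : Fin 3) 1)) ∧ U e ≤ t) ∨ (¬ (∃ x : Site 3, e = s(x, x + Pi.single (2 : Fin 3) 1)) ∧ U e ≤ p))} ∈ siteToBoundary 3 n} ≤ 1 := by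
  have := isProbabilityMeasure_labelMeasure (Site 3)
  exact measureReal_le_one

/-- **Edge `p ≥ 1`: `Θ_n(p,t) = 1`.** Almost surely every label is `≤ 1 ≤ p`, so the straight
`x`-ray is open and reaches `n e_x ∈ ∂Λ_n`. [folklore] -/
theorem theta_eq_one_of_one_le_p {p : ℝ} (hp : 1 ≤ p) (n : ℕ) (t : ℝ) : (labelMeasure (Site 3)).real {U : Sym2 (Site 3) → ℝ | {e | e ∈ (zdGraph 3).edgeSet ∧ (((∃ x : Site 3, e = s(x, x + Pi.single (2 : Fin 3) 1)) ∧ U e ≤ t) ∨ (¬ (∃ x : Site 3, e = s(x, x + Pi.single (2 : Fin 3) 1)) ∧ U e ≤ p))} ∈ siteToBoundary 3 n} = 1 := by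
  have := isProbabilityMeasure_labelMeasure (Site 3)
  have hae : ∀ᵐ U ∂(labelMeasure (Site 3)), {e | e ∈ (zdGraph 3).edgeSet ∧ (((∃ x : Site 3, e = s(x, x + Pi.single (2 : Fin 3) 1)) ∧ U e ≤ t) ∨ (¬ (∃ x : Site 3, e = s(x, x + Pi.single (2 : Fin 3) 1)) ∧ U e ≤ p))} ∈ siteToBoundary 3 n := by
    filter_upwards [ae_label_le_one] with U hU
    exact mem_siteToBoundary_of_axis_open 0 fun k _ =>
      ⟨(SimpleGraph.mem_edgeSet _).2 (axis_adj_succ 0 k),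
        Or.inr ⟨not_vert_axis_zero k, (hU _).trans hp⟩⟩
  rw [measureReal_congr (ae_eq_univ.2 (mem_ae_iff.1 hae)), probReal_univ]

/-- **Edge `t ≥ 1`: `Θ_n(p,t) = 1`.** Almost surely every label is `≤ 1 ≤ t`, so the vertical
ray is open and reaches `n e_z ∈ ∂Λ_n`. [folklore] -/
theorem theta_eq_one_of_one_le_t {t : ℝ} (ht : 1 ≤ t) (n : ℕ) (p : ℝ) : (labelMeasure (Site 3)).real {U : Sym2 (Site 3) → ℝ | {e | e ∈ (zdGraph 3).edgeSet ∧ (((∃ x : Site 3, e = s(x, x + Pi.single (2 : Fin 3) 1)) ∧ U e ≤ t) ∨ (¬ (∃ x : Site 3, e = s(x, x + Pi.single (2 : Fin 3) 1)) ∧ U e ≤ p))} ∈ siteToBoundary 3 n} = 1 := by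
  have := isProbabilityMeasure_labelMeasure (Site 3)
  have hae : ∀ᵐ U ∂(labelMeasure (Site 3)), {e | e ∈ (zdGraph 3).edgeSet ∧ (((∃ x : Site 3, e = s(x, x + Pi.single (2 : Fin 3) 1)) ∧ U e ≤ t) ∨ (¬ (∃ x : Site 3, e = s(x, x + Pi.single (2 : Fin 3) 1)) ∧ U e ≤ p))} ∈ siteToBoundary 3 n := by
    filter_upwards [ae_label_le_one] with U hU
    exact mem_siteToBoundary_of_axis_open 2 fun k _ =>
      ⟨(SimpleGraph.mem_edgeSet _).2 (axis_adj_succ 2 k),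
        Or.inl ⟨vert_axis_two k, (hU _).trans ht⟩⟩
  rw [measureReal_congr (ae_eq_univ.2 (mem_ae_iff.1 hae)), probReal_univ]

/-- **Edge `p ≤ 0`: `Θ_n(q,t) = Θ_n(0,t)` for `q ≤ 0`.** Almost surely every label is `> 0`, so
at any level `q ≤ 0` no horizontal bond is open and the configuration does not depend on `q`.
[folklore] -/
theorem theta_eq_theta_zero_of_nonpos {q : ℝ} (hq : q ≤ 0) (n : ℕ) (t : ℝ) :
    (labelMeasure (Site 3)).real {U : Sym2 (Site 3) → ℝ | {e | e ∈ (zdGraph 3).edgeSet ∧ (((∃ x : Site 3, e = s(x, x + Pi.single (2 : Fin 3) 1)) ∧ U e ≤ t) ∨ (¬ (∃ x : Site 3, e = s(x, x + Pi.single (2 : Fin 3) 1)) ∧ U e ≤ q))} ∈ siteToBoundary 3 n} = (labelMeasure (Site 3)).real {U : Sym2 (Site 3) → ℝ | {e | e ∈ (zdGraph 3).edgeSet ∧ (((∃ x : Site 3, e = s(x, x + Pi.single (2 : Fin 3) 1)) ∧ U e ≤ t) ∨ (¬ (∃ x : Site 3, e = s(x, x + Pi.single (2 : Fin 3) 1))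 ∧ U e ≤ 0))} ∈ siteToBoundary 3 n} := by
  refine measureReal_congr ?_
  filter_upwards [ae_label_pos] with U hU
  have hc : {e | e ∈ (zdGraph 3).edgeSet ∧ (((∃ x : Site 3, e = s(x, x + Pi.single (2 : Fin 3) 1)) ∧ U e ≤ t) ∨ (¬ (∃ x : Site 3, e = s(x, x + Pi.single (2 : Fin 3) 1)) ∧ U e ≤ q))} = {e | e ∈ (zdGraph 3).edgeSet ∧ (((∃ x : Site 3, e = s(x, x + Pi.single (2 : Fin 3) 1)) ∧ U e ≤ t) ∨ (¬ (∃ x : Site 3, e = s(x, x + Pi.single (2 : Fin 3) 1)) ∧ U e ≤ 0))} := by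
    ext e
    simp only [Set.mem_setOf_eq]
    constructor
    · rintro ⟨he, h | h⟩
      · exact ⟨he, Or.inl h⟩
      · exact ⟨he, Or.inr ⟨h.1, h.2.trans hq⟩⟩
    · rintro ⟨he, h | h⟩
      · exact ⟨he, Or.inl h⟩
      · exact ((not_le.2 (hU e)) h.2).elim
  show ({e | e ∈ (zdGraph 3).edgeSet ∧ (((∃ x : Site 3, e = s(x, x + Pi.single (2 : Fin 3) 1)) ∧ U e ≤ t) ∨ (¬ (∃ x : Site 3, e = s(x, x + Pi.single (2 : Fin 3) 1)) ∧ U e ≤ q))} ∈ siteToBoundary 3 n) = ({e | e ∈ (zdGraph 3).edgeSet ∧ (((∃ x : Site 3, e = s(x, x + Pi.single (2 : Fin 3) 1)) ∧ U e ≤ t) ∨ (¬ (∃ x : Site 3, e = s(x, x + Pi.single (2 : Fin 3) 1)) ∧ U e ≤ 0))} ∈ siteToBoundary 3 n)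
  rw [hc]

/-- **`∂_pΘ_n(1,t) = 0`**: `Θ_n(·,t)` attains its maximum `1` at `p = 1` (Fermat). At `p = 1`
no horizontal bond is pivotal. [folklore] -/
theorem deriv_theta_p_at_one (n : ℕ) (t : ℝ) : deriv (fun q : ℝ => (labelMeasure (Site 3)).real {U : Sym2 (Site 3) → ℝ | {e | e ∈ (zdGraph 3).edgeSet ∧ (((∃ x : Site 3, e = s(x, x + Pi.single (2 : Fin 3) 1)) ∧ U e ≤ t) ∨ (¬ (∃ x : Site 3, e = s(x, x + Pi.single (2 : Fin 3) 1)) ∧ U e ≤ q))} ∈ siteToBoundary 3 n}) 1 = 0 := by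
  refine IsLocalMax.deriv_eq_zero (Filter.Eventually.of_forall fun q => ?_)
  show (labelMeasure (Site 3)).real {U : Sym2 (Site 3) → ℝ | {e | e ∈ (zdGraph 3).edgeSet ∧ (((∃ x : Site 3, e = s(x, x + Pi.single (2 : Fin 3) 1)) ∧ U e ≤ t) ∨ (¬ (∃ x : Site 3, e = s(x, x + Pi.single (2 : Fin 3) 1)) ∧ U e ≤ q))} ∈ siteToBoundary 3 n} ≤ (labelMeasure (Site 3)).real {U : Sym2 (Site 3) → ℝ | {e | e ∈ (zdGraph 3).edgeSet ∧ (((∃ x : Site 3, e = s(x, x + Pi.single (2 : Fin 3) 1)) ∧ U e ≤ t) ∨ (¬ (∃ x : Site 3, e = s(x, x + Pi.single (2 : Fin 3) 1)) ∧ U e ≤ 1))} ∈ siteToBoundary 3 n}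
  rw [theta_eq_one_of_one_le_p le_rfl n t]
  exact theta_le_one n q t

/-- **`∂_pΘ_n(p,t) = 0` for `t ≥ 1`**: `Θ_n(·,t) ≡ 1` (the vertical ray alone connects `0` to
`∂Λ_n`, no bond is pivotal). [folklore] -/
theorem deriv_theta_p_of_one_le_t {t : ℝ} (ht : 1 ≤ t) (n : ℕ) (p : ℝ) :
    deriv (fun q : ℝ => (labelMeasure (Site 3)).real {U : Sym2 (Site 3) → ℝ | {e | e ∈ (zdGraph 3).edgeSet ∧ (((∃ x : Site 3, e = s(x, x + Pi.single (2 : Fin 3) 1)) ∧ U e ≤ t) ∨ (¬ (∃ x : Site 3, e = s(x, x + Pi.single (2 : Fin 3) 1)) ∧ U e ≤ q))} ∈ siteToBoundary 3 n}) p = 0 := by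
  have h : (fun q : ℝ => (labelMeasure (Site 3)).real {U : Sym2 (Site 3) → ℝ | {e | e ∈ (zdGraph 3).edgeSet ∧ (((∃ x : Site 3, e = s(x, x + Pi.single (2 : Fin 3) 1)) ∧ U e ≤ t) ∨ (¬ (∃ x : Site 3, e = s(x, x + Pi.single (2 : Fin 3) 1)) ∧ U e ≤ q))} ∈ siteToBoundary 3 n}) = fun _ => (1 : ℝ) :=
    funext fun q => theta_eq_one_of_one_le_t ht n q
  rw [h, deriv_const]

/-- **`deriv (Θ_n(·,t)) 0 = 0`**: `0` is a (non-strict) local minimum of `Θ_n(·,t)` — plateau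
`Θ_n(q,t) = Θ_n(0,t)` for `q ≤ 0`, monotone for `q ≥ 0` — so Fermat's theorem (which in Mathlib
also covers the non-differentiable corner, where `deriv` is the junk value `0`) gives `0`.
[folklore] -/
theorem deriv_theta_p_at_zero (n : ℕ) (t : ℝ) : deriv (fun q : ℝ => (labelMeasure (Site 3)).real {U : Sym2 (Site 3) → ℝ | {e | e ∈ (zdGraph 3).edgeSet ∧ (((∃ x : Site 3, e = s(x, x + Pi.single (2 : Fin 3) 1)) ∧ U e ≤ t) ∨ (¬ (∃ x : Site 3, e = s(x, x + Pi.single (2 : Fin 3) 1)) ∧ U e ≤ q))} ∈ siteToBoundary 3 n}) 0 = 0 := by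
  refine IsLocalMin.deriv_eq_zero (Filter.Eventually.of_forall fun q => ?_)
  show (labelMeasure (Site 3)).real {U : Sym2 (Site 3) → ℝ | {e | e ∈ (zdGraph 3).edgeSet ∧ (((∃ x : Site 3, e = s(x, x + Pi.single (2 : Fin 3) 1)) ∧ U e ≤ t) ∨ (¬ (∃ x : Site 3, e = s(x, x + Pi.single (2 : Fin 3) 1)) ∧ U e ≤ 0))} ∈ siteToBoundary 3 n} ≤ (labelMeasure (Site 3)).real {U : Sym2 (Site 3) → ℝ | {e | e ∈ (zdGraph 3).edgeSet ∧ (((∃ x : Site 3, e = s(x, x + Pi.single (2 : Fin 3) 1)) ∧ U e ≤ t) ∨ (¬ (∃ x : Site 3, e = s(x, x + Pi.single (2 : Fin 3) 1)) ∧ U e ≤ q))} ∈ siteToBoundary 3 n}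
  rcases le_total q 0 with hq | hq
  · rw [theta_eq_theta_zero_of_nonpos hq]
  · exact SubcritExchangeUniformity.thetaBox_mono_p n t hq

/-! ## Tightness of the open-square guard in clause (8) of `ModelFacts` -/

/-- **Clause (8) is false on the edge `p = 1`.** With the crux's own `let`-prefix, strict
positivity `0 < deriv (fun q => Θ n q t) p` FAILS if `p` ranges over `Ioc 0 1` instead of
`Ioo 0 1`: at `p = 1`, `Θ_n(·,t)` is maximal and its derivative vanishes (witness `n = 1`,
`p = 1`, `t = 1/2`). So `p < 1` in clause (8) is load-bearing. [folklore] -/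
theorem modelFacts_derivPos_false_at_p_one :
    ¬ (let μ := Literature.Probability.Percolation.labelMeasure (Literature.Probability.LatticeModels.Site 3)
       let vert : Sym2 (Literature.Probability.LatticeModels.Site 3) → Prop :=
         fun e => ∃ x : Literature.Probability.LatticeModels.Site 3, e = s(x, x + Pi.single (2 : Fin 3) 1)
       let cfg : ℝ → ℝ → (Sym2 (Literature.Probability.LatticeModels.Site 3) → ℝ) →
           Set (Sym2 (Literature.Probability.LatticeModels.Site 3)) :=
         fun p t U => {e | e ∈ (Literature.Probability.LatticeModels.zdGraph 3).edgeSet ∧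
           ((vert e ∧ U e ≤ t) ∨ (¬ vert e ∧ U e ≤ p))}
       let Θ : ℕ → ℝ → ℝ → ℝ :=
         fun n p t => μ.real {U | cfg p t U ∈ Literature.Probability.Percolation.siteToBoundary 3 n}
       ∀ n : ℕ, 1 ≤ n → ∀ p ∈ Set.Ioc (0 : ℝ) 1, ∀ t ∈ Set.Ioo (0 : ℝ) 1,
         0 < deriv (fun q => Θ n q t) p) := by
  intro h
  have h0 := h 1 le_rfl 1 ⟨one_pos, le_rfl⟩ (1 / 2) ⟨by norm_num, by norm_num⟩
  exact h0.ne' (deriv_theta_p_at_one 1 (1 / 2))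

/-- **Clause (8) is false on the edge `p = 0`.** If `p` ranges over `Ico 0 1` instead of
`Ioo 0 1`, strict positivity fails at `p = 0`: `Θ_n(·,t)` is constant on `(-∞,0]` and monotone,
so `0` is a local minimum and `deriv` vanishes there (Fermat; at the corner `deriv` is Lean's junk
`0`). Witness `n = 1`, `p = 0`, `t = 1/2`. So `0 < p` in clause (8) is load-bearing. [folklore] -/
theorem modelFacts_derivPos_false_at_p_zero :
    ¬ (let μ := Literature.Probability.Percolation.labelMeasure (Literature.Probability.LatticeModels.Site 3)
       let vert : Sym2 (Literature.Probability.LatticeModels.Site 3) → Prop :=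
         fun e => ∃ x : Literature.Probability.LatticeModels.Site 3, e = s(x, x + Pi.single (2 : Fin 3) 1)
       let cfg : ℝ → ℝ → (Sym2 (Literature.Probability.LatticeModels.Site 3) → ℝ) →
           Set (Sym2 (Literature.Probability.LatticeModels.Site 3)) :=
         fun p t U => {e | e ∈ (Literature.Probability.LatticeModels.zdGraph 3).edgeSet ∧
           ((vert e ∧ U e ≤ t) ∨ (¬ vert e ∧ U e ≤ p))}
       let Θ : ℕ → ℝ → ℝ → ℝ :=
         fun n p t => μ.real {U | cfg p t U ∈ Literature.Probability.Percolation.siteToBoundary 3 n}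
       ∀ n : ℕ, 1 ≤ n → ∀ p ∈ Set.Ico (0 : ℝ) 1, ∀ t ∈ Set.Ioo (0 : ℝ) 1,
         0 < deriv (fun q => Θ n q t) p) := by
  intro h
  have h0 := h 1 le_rfl 0 ⟨le_rfl, one_pos⟩ (1 / 2) ⟨by norm_num, by norm_num⟩
  exact h0.ne' (deriv_theta_p_at_zero 1 (1 / 2))

/-- **Clause (8) is false on the edge `t = 1`.** If `t` ranges over `Ioc 0 1` instead of
`Ioo 0 1`, strict positivity of the `p`-derivative fails at `t = 1`: the vertical ray is open, so
`Θ_n(·,1) ≡ 1` and `∂_pΘ_n(p,1) = 0` for every `p` (witness `n = 1`, `p = 1/2`, `t = 1`). So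
`t < 1` in clause (8) is load-bearing. (The edge `t = 0` is not: there `∂_pΘ_n(p,0) > 0` still
holds, a.s. planar percolation in the layer `ℤ²×{0}` — not proved here.) [folklore] -/
theorem modelFacts_derivPos_false_at_t_one :
    ¬ (let μ := Literature.Probability.Percolation.labelMeasure (Literature.Probability.LatticeModels.Site 3)
       let vert : Sym2 (Literature.Probability.LatticeModels.Site 3) → Prop :=
         fun e => ∃ x : Literature.Probability.LatticeModels.Site 3, e = s(x, x + Pi.single (2 : Fin 3) 1)
       let cfg : ℝ → ℝ → (Sym2 (Literature.Probability.LatticeModels.Site 3) → ℝ) →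
           Set (Sym2 (Literature.Probability.LatticeModels.Site 3)) :=
         fun p t U => {e | e ∈ (Literature.Probability.LatticeModels.zdGraph 3).edgeSet ∧
           ((vert e ∧ U e ≤ t) ∨ (¬ vert e ∧ U e ≤ p))}
       let Θ : ℕ → ℝ → ℝ → ℝ :=
         fun n p t => μ.real {U | cfg p t U ∈ Literature.Probability.Percolation.siteToBoundary 3 n}
       ∀ n : ℕ, 1 ≤ n → ∀ p ∈ Set.Ioo (0 : ℝ) 1, ∀ t ∈ Set.Ioc (0 : ℝ) 1,
         0 < deriv (fun q => Θ n q t) p) := by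
  intro h
  have h0 := h 1 le_rfl (1 / 2) ⟨by norm_num, by norm_num⟩ 1 ⟨one_pos, le_rfl⟩
  exact h0.ne' (deriv_theta_p_of_one_le_t le_rfl 1 (1 / 2))

end Summit.CriticalPhenomena.PercolationContinuityZ3.Theorems.ModelFacts.Negative

end
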